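import Literature.Analysis.SpecialFunctions.EllipticKAGMEnclosure
import Literature.Analysis.ValidatedNumerics.Certificate
import HarnessLib

/-!
# Kernel-checkable certificates for values of the complete elliptic integral `K(m)`

Topic `Literature/Analysis/ValidatedNumerics`. A **row certificate** for the claim
`lo ≤ K(m) ≤ hi` (`K = Literature.Probability.RandomPlanarGeometry.ellipticK`, parameter convention,
`m < 1`; `lo, hi, m ∈ ℚ`) consists of two finite AGM chains with rational entries — one with the
arithmetic/geometric means rounded UP, one rounded DOWN — as produced by any exact-rational or
fixed-point implementation of the AGM iteration for `M(1, √(1-m))` (Brent–Zimmermann §4.8;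
Borwein–Borwein Thm 1.1 `K(m) = π/(2M(1,√(1-m)))`). The Boolean checker `KRowCert.check` verifies,
in exact rational arithmetic, the finitely many polynomial inequalities under which the tree's
`le_ellipticK_of_agmChainUp` / `ellipticK_le_of_agmChainDown` (`EllipticKAGMEnclosure.lean`) apply,
with `π` enclosed by Mathlib's twenty-digit bounds `Real.pi_gt_d20` / `Real.pi_lt_d20`; the soundness
theorem `KRowCert.sound` turns `check = true` (decided by `decide` in the kernel) into the real
inequalities. This is the T-VALNUM shape of `Certificate.lean` (`KRowCert.verifier`).

* `KRowCert`, `KRowCert.check`, `KRowCert.sound`, `KRowCert.verifier`;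
* `ellipticK_half_mem_Icc_cert` — the worked row `1.854074 ≤ K(1/2) ≤ 1.854075` re-certified through
  the checker by `decide` (cf. `ellipticK_half_mem_Icc`, proved by `norm_num`).

Between certified grid points, `K` is enclosed WITHOUT further certificates by monotonicity
(`ellipticK_mono`), the chord bound (`ellipticK_le_chord`) and the secant envelopes
(`ellipticK_secant_mono_left/right`, `EllipticKConvex.lean`).

## References
* [BrentZimmermann2010] R. P. Brent, P. Zimmermann, *Modern Computer Arithmetic*, CUP (2010), §4.8.
* [BorweinBorwein1987] J. M. Borwein, P. B. Borwein, *Pi and the AGM*, Wiley (1987), Thm 1.1.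
-/

noncomputable section

open _root_.Set
open Literature.Probability.RandomPlanarGeometry Literature.Analysis.SpecialFunctions

namespace Literature.Analysis.ValidatedNumerics

/-- Twenty-digit rational lower bound for `π` (Mathlib `Real.pi_gt_d20`). [cite: BrentZimmermann2010, §4.8] -/
def piLo20 : ℚ := 3.14159265358979323846

/-- Twenty-digit rational upper bound for `π` (Mathlib `Real.pi_lt_d20`). [cite: BrentZimmermann2010, §4.8] -/
def piHi20 : ℚ := 3.14159265358979323847

/-- `piLo20 < π`. [cite: BrentZimmermann2010, §4.8] -/
theorem piLo20_lt_pi : ((piLo20 : ℚ) : ℝ) < Real.pi := by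
  have h := Real.pi_gt_d20
  unfold piLo20
  exact_mod_cast h

/-- `π < piHi20`. [cite: BrentZimmermann2010, §4.8] -/
theorem pi_lt_piHi20 : Real.pi < ((piHi20 : ℚ) : ℝ) := by
  have h := Real.pi_lt_d20
  unfold piHi20
  exact_mod_cast h

/-- **Row certificate for `lo ≤ K(m) ≤ hi`.** `up` is an AGM chain `(Aᵢ, Bᵢ)`, `i = 0 … N`, with
means rounded up and started above `(1, √(1-m))`; `down` one with means rounded down, started
below. Entries are rationals (typically decimal or dyadic fixed point).
[cite: BrentZimmermann2010, §4.8] -/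
structure KRowCert where
  /-- the parameter (`m < 1`) -/
  m : ℚ
  /-- claimed lower bound for `K(m)` -/
  lo : ℚ
  /-- claimed upper bound for `K(m)` -/
  hi : ℚ
  /-- rounded-up AGM chain `[(A₀,B₀), …, (A_N,B_N)]` -/
  up : List (ℚ × ℚ)
  /-- rounded-down AGM chain -/
  down : List (ℚ × ℚ)

namespace KRowCert

/-- `i`-th pair of a chain (junk `(0,0)` past the end; the checker only reads valid indices).
[cite: BrentZimmermann2010, §4.8] -/
def entry (l : List (ℚ × ℚ)) (i : ℕ) : ℚ × ℚ := l.getD i (0, 0)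

/-- All entries of a chain are nonnegative. [cite: BrentZimmermann2010, §4.8] -/
def nonnegOK (l : List (ℚ × ℚ)) : Bool :=
  (List.range l.length).all fun i => decide (0 ≤ (entry l i).1) && decide (0 ≤ (entry l i).2)

/-- Rounded-UP steps: `(Aᵢ+Bᵢ)/2 ≤ Aᵢ₊₁` and `AᵢBᵢ ≤ Bᵢ₊₁²`. [cite: BrentZimmermann2010, §4.8] -/
def stepsUpOK (l : List (ℚ × ℚ)) : Bool :=
  (List.range (l.length - 1)).all fun i =>
    decide (((entry l i).1 + (entry l i).2) / 2 ≤ (entry l (i + 1)).1) &&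
      decide ((entry l i).1 * (entry l i).2 ≤ (entry l (i + 1)).2 ^ 2)

/-- Rounded-DOWN steps: `Aᵢ₊₁ ≤ (Aᵢ+Bᵢ)/2` and `Bᵢ₊₁² ≤ AᵢBᵢ`. [cite: BrentZimmermann2010, §4.8] -/
def stepsDownOK (l : List (ℚ × ℚ)) : Bool :=
  (List.range (l.length - 1)).all fun i =>
    decide ((entry l (i + 1)).1 ≤ ((entry l i).1 + (entry l i).2) / 2) &&
      decide ((entry l (i + 1)).2 ^ 2 ≤ (entry l i).1 * (entry l i).2)

/-- **The checker**: all side conditions of `le_ellipticK_of_agmChainUp` (for `lo`) and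
`ellipticK_le_of_agmChainDown` (for `hi`) in exact rational arithmetic, with `π ∈ [piLo20, piHi20]`.
[cite: BrentZimmermann2010, §4.8] -/
def check (r : KRowCert) : Bool :=
  decide (r.m < 1) &&
  -- lower bound from the rounded-up chain
  decide (0 < r.up.length) && nonnegOK r.up && stepsUpOK r.up &&
  decide (1 ≤ (entry r.up 0).1) && decide (1 - r.m ≤ (entry r.up 0).2 ^ 2) &&
  decide (0 < max (entry r.up (r.up.length - 1)).1 (entry r.up (r.up.length - 1)).2) &&
  decide (r.lo * (2 * max (entry r.up (r.up.length - 1)).1 (entry r.up (r.up.length - 1)).2) ≤ piLo20) &&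
  -- upper bound from the rounded-down chain
  decide (0 < r.down.length) && nonnegOK r.down && stepsDownOK r.down &&
  decide ((entry r.down 0).1 ≤ 1) && decide ((entry r.down 0).2 ^ 2 ≤ 1 - r.m) &&
  decide (0 < min (entry r.down (r.down.length - 1)).1 (entry r.down (r.down.length - 1)).2) &&
  decide (piHi20 ≤ r.hi * (2 * min (entry r.down (r.down.length - 1)).1 (entry r.down (r.down.length - 1)).2))

/-- Unpacking `nonnegOK`. [cite: BrentZimmermann2010, §4.8] -/
theorem nonnegOK_iff (l : List (ℚ × ℚ)) :
    nonnegOK l = true ↔ ∀ i < l.length, 0 ≤ (entry l i).1 ∧ 0 ≤ (entry l i).2 := by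
  simp [nonnegOK, List.all_eq_true, List.mem_range]

/-- Unpacking `stepsUpOK`. [cite: BrentZimmermann2010, §4.8] -/
theorem stepsUpOK_iff (l : List (ℚ × ℚ)) :
    stepsUpOK l = true ↔ ∀ i < l.length - 1,
      ((entry l i).1 + (entry l i).2) / 2 ≤ (entry l (i + 1)).1 ∧
        (entry l i).1 * (entry l i).2 ≤ (entry l (i + 1)).2 ^ 2 := by
  simp [stepsUpOK, List.all_eq_true, List.mem_range]

/-- Unpacking `stepsDownOK`. [cite: BrentZimmermann2010, §4.8] -/
theorem stepsDownOK_iff (l : List (ℚ × ℚ)) :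
    stepsDownOK l = true ↔ ∀ i < l.length - 1,
      (entry l (i + 1)).1 ≤ ((entry l i).1 + (entry l i).2) / 2 ∧
        (entry l (i + 1)).2 ^ 2 ≤ (entry l i).1 * (entry l i).2 := by
  simp [stepsDownOK, List.all_eq_true, List.mem_range]

/-- **Soundness of the row checker**: `r.check = true ⟹ lo ≤ K(m) ≤ hi`.
[cite: BrentZimmermann2010, §4.8] -/
theorem sound (r : KRowCert) (h : r.check = true) :
    ((r.lo : ℚ) : ℝ) ≤ ellipticK (r.m : ℝ) ∧ ellipticK (r.m : ℝ) ≤ ((r.hi : ℚ) : ℝ) := by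
  simp only [check, Bool.and_eq_true, decide_eq_true_eq] at h
  obtain ⟨⟨⟨⟨⟨⟨⟨⟨⟨⟨⟨⟨⟨⟨hm, hupLen⟩, hupNN⟩, hupSt⟩, hA0⟩, hB0⟩, hUpos⟩, hlo⟩, hdnLen⟩, hdnNN⟩,
    hdnSt⟩, hA0'⟩, hB0'⟩, hLpos⟩, hhi⟩ := h
  rw [nonnegOK_iff] at hupNN hdnNN
  rw [stepsUpOK_iff] at hupSt
  rw [stepsDownOK_iff] at hdnSt
  have hmR : ((r.m : ℚ) : ℝ) < 1 := by exact_mod_cast hm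
  constructor
  · -- lower bound
    set N := r.up.length - 1 with hN
    set A : ℕ → ℝ := fun i => ((entry r.up i).1 : ℝ) with hA
    set B : ℕ → ℝ := fun i => ((entry r.up i).2 : ℝ) with hB
    have key := le_ellipticK_of_agmChainUp hmR (N := N) (A := A) (B := B)
      (fun i hi => by simp only [hA]; exact_mod_cast (hupNN i (by omega)).1)
      (fun i hi => by simp only [hB]; exact_mod_cast (hupNN i (by omega)).2)
      (by simp only [hA]; exact_mod_cast hA0)
      (by simp only [hB]; exact_mod_cast hB0)
      (fun i hi => by simp only [hA, hB]; exact_mod_cast (hupSt i (by omega)).1)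
      (fun i hi => by simp only [hA, hB]; exact_mod_cast (hupSt i (by omega)).2)
      piLo20_lt_pi.le
    refine le_trans ?_ key
    have hUposR : (0 : ℝ) < max (A N) (B N) := by
      simp only [hA, hB, hN]; exact_mod_cast hUpos
    rw [le_div_iff₀ (by positivity)]
    have : ((r.lo : ℚ) : ℝ) * (2 * max (A N) (B N)) ≤ ((piLo20 : ℚ) : ℝ) := by
      simp only [hA, hB, hN]; exact_mod_cast hlo
    linarith
  · -- upper bound
    set N := r.down.length - 1 with hN
    set A : ℕ → ℝ := fun i => ((entry r.down i).1 : ℝ) with hA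
    set B : ℕ → ℝ := fun i => ((entry r.down i).2 : ℝ) with hB
    have hLposR : (0 : ℝ) < min (A N) (B N) := by
      simp only [hA, hB, hN]; exact_mod_cast hLpos
    have key := ellipticK_le_of_agmChainDown hmR (N := N) (A := A) (B := B)
      (fun i hi => by simp only [hA]; exact_mod_cast (hdnNN i (by omega)).1)
      (fun i hi => by simp only [hB]; exact_mod_cast (hdnNN i (by omega)).2)
      (by simp only [hA]; exact_mod_cast hA0')
      (by simp only [hB]; exact_mod_cast hB0')
      (fun i hi => by simp only [hA, hB]; exact_mod_cast (hdnSt i (by omega)).1)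
      (fun i hi => by simp only [hA, hB]; exact_mod_cast (hdnSt i (by omega)).2)
      hLposR pi_lt_piHi20.le
    refine le_trans key ?_
    rw [div_le_iff₀ (by positivity)]
    have : ((piHi20 : ℚ) : ℝ) ≤ ((r.hi : ℚ) : ℝ) * (2 * min (A N) (B N)) := by
      simp only [hA, hB, hN]; exact_mod_cast hhi
    linarith

/-- The row checker as a `Verifier` (T-VALNUM shape): claims indexed by `(m, lo, hi)`, certificates
= pairs of chains. [cite: BrentZimmermann2010, §4.8] -/
def verifier : Verifier (ℚ × ℚ × ℚ)
    (fun q => ((q.2.1 : ℚ) : ℝ) ≤ ellipticK (q.1 : ℝ) ∧ ellipticK (q.1 : ℝ) ≤ ((q.2.2 : ℚ) : ℝ)) where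
  Cert := List (ℚ × ℚ) × List (ℚ × ℚ)
  check q c := check ⟨q.1, q.2.1, q.2.2, c.1, c.2⟩
  sound q c h := sound ⟨q.1, q.2.1, q.2.2, c.1, c.2⟩ h

end KRowCert

/-! ### Worked row -/

/-- The certificate of `1.854074 ≤ K(1/2) ≤ 1.854075`: two four-step AGM chains for `M(1, √(1/2))`
with square roots rounded to `10⁻⁹` (the data of `ellipticK_half_mem_Icc`).
[cite: AbramowitzStegun1964, Table 17.1] -/
def kRowHalf : KRowCert where
  m := 1 / 2
  lo := 1854074 / 1000000
  hi := 1854075 / 1000000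
  up := [(1, 353553391/500000000), (853553391/1000000000, 26278013/31250000),
    (1694449807/2000000000, 211800317/250000000), (3388852343/4000000000, 423606543/500000000),
    (6777704687/8000000000, 423606543/500000000)]
  down := [(1, 707106781/1000000000), (1707106781/2000000000, 168179283/200000000),
    (3388899611/4000000000, 423600633/500000000), (271108187/320000000, 211803271/250000000),
    (13555409347/16000000000, 211803271/250000000)]

/-- **`1.854074 ≤ K(1/2) ≤ 1.854075` by certificate**: the checker runs inside the kernel
(`decide +kernel`). [cite: AbramowitzStegun1964, Table 17.1] -/
theorem ellipticK_half_mem_Icc_cert :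
    ((kRowHalf.lo : ℚ) : ℝ) ≤ ellipticK (kRowHalf.m : ℝ) ∧
      ellipticK (kRowHalf.m : ℝ) ≤ ((kRowHalf.hi : ℚ) : ℝ) :=
  KRowCert.sound kRowHalf (by decide +kernel)

end Literature.Analysis.ValidatedNumerics

end
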